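import Mathlib
import Summits.ResolutionOfSingularities.ResolutionOfSingularities.Theorems.RadicialJungCleanModelsCleanLU3ArcQConst
import HarnessLib

/-!
# Route `RadicialJung`, crux `CleanModels` (stmt-15917), stub `stub_cleanLU3DefectArcInfinite`: the quadratic sequence along an
# ARC in the `π`-chart — peeling, divisibility of `𝔪ⁱ`-powers, and the TOWER FORM of a coordinate with `Q`-constant digits

Line `Sketch` rev 20 of crux stmt-ResolutionOfSingularities-15917; lead `res-B-lead-1` g3.  OURS; nothing here proves resolution in
characteristic `p`.

Setting: `R₀ → R₁ → ⋯` quadratic transforms along a valuation ring `O`, `π ∈ R₀` a nonzero element of `𝔪_O` whose value bounds every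
value `< 1` (discrete rank one).  Then every step is the `π`-chart:

* `succ_eq_locAtCentre_blowupRing` — `R_{i+1} = (Rᵢ[𝔪ᵢ/π])_{𝔪_O ∩ ·}` and `π ∈ Rᵢ` for all `i`;
* `div_mem_succ_of_lt`, `div_pow_mem_succ_of_mem_pow` — `𝔪ᵢ ⊆ π R_{i+1}`, `𝔪ᵢ^d ⊆ π^d R_{i+1}`;
* `exists_eq_pow_mul_unit` («peeling») — an element of `Rᵢ` of value `(v π)^e` is `π^e · u` with `u` a unit of `R_{i+e}`;
* `exists_tower_form` — **tower form with `Q`-constant digits**: if every residue of every `Rᵢ` is a `p`-th power, every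
  `y ∈ 𝔪₀` is, for every `j`, `y = P(π) + π^j θ` with `P` a polynomial whose coefficients are `Q`-th powers (`Q = p^s`) of elements of
  `Rⱼ` and `θ ∈ 𝔪ⱼ` — the algebraic counterpart of the truncated arc `y = Σ_{r ≤ j} [a_r] π^r + π^j θ` with Teichmüller digits.
-/

noncomputable section

set_option linter.dupNamespace false -- mandated namespace of this single-conjunct summit

open IsLocalRing
open Literature.AlgebraicGeometry.Resolution

namespace Summit.ResolutionOfSingularities.ResolutionOfSingularities.Theorems.RadicialJung.CleanModels

variable {K : Type} [Field K]

section Tower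

variable {O : ValuationSubring K} (R : ℕ → Subring K) [hR : ∀ i, IsLocalRing (R i)]
  (h0 : SubringDominates (R 0) O.toSubring) (hstep : ∀ i, IsQuadraticTransformAlong O (R i) (R (i + 1)))
  (π : K) (hπR : π ∈ R 0) (hπ0 : π ≠ 0) (hvπ : O.valuation π < 1)
  (hπ : ∀ x : K, O.valuation x < 1 → O.valuation x ≤ O.valuation π)

include h0 hstep hπR hπ0 hvπ hπ

/-- **Every step is the `π`-chart**: `π ∈ Rᵢ` and `R_{i+1} = locAtCentre (Rᵢ[𝔪ᵢ/π]) O`. [folklore] -/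
theorem succ_eq_locAtCentre_blowupRing :
    ∀ i, ∃ _ : π ∈ R i, R (i + 1) = locAtCentre (blowupRing (R i) π) O := by
  classical
  intro i
  have hπi : π ∈ R i := sequence_monotone hstep (Nat.zero_le i) hπR
  refine ⟨hπi, ?_⟩
  have hdom : SubringDominates (R i) O.toSubring := (sequence_dominates h0 hstep i).1
  have hmem : ∀ a : R i, a ∈ maximalIdeal (R i) ↔ O.valuation (a : K) < 1 :=
    (subringDominates_valuationSubring_iff hdom.1).mp hdom
  obtain ⟨_, u, hu⟩ := (hstep i).fg_maximalIdeal
  let πi : R i := ⟨π, hπi⟩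
  have hπm : πi ∈ maximalIdeal (R i) := (hmem πi).mpr hvπ
  let u' : Finset (R i) := insert πi u
  have hu' : Ideal.span (↑u' : Set (R i)) = maximalIdeal (R i) := by
    apply le_antisymm
    · rw [Ideal.span_le]
      intro x hx
      rw [Finset.coe_insert, Set.mem_insert_iff] at hx
      rcases hx with rfl | hx
      · exact hπm
      · rw [← hu]; exact Ideal.subset_span hx
    · rw [← hu]; exact Ideal.span_mono (by rw [Finset.coe_insert]; exact Set.subset_insert _ _)
  have hQT : IsQuadraticTransformAlong O (R i) (locAtCentre (blowupRing (R i) π) O) := by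
    refine ⟨‹_›, hdom.1, u', πi, hu', Finset.mem_insert_self _ _, fun h => hπ0 (congrArg Subtype.val h), ?_, ?_⟩
    · intro x hx
      have hxm : x ∈ maximalIdeal (R i) := by rw [← hu']; exact Ideal.subset_span hx
      exact hπ _ ((hmem x).mp hxm)
    · rw [blowupRing_eq_closure_of_span_eq π (↑u') hu']
  exact (hstep i).unique hQT

/-- `𝔪ᵢ ⊆ π R_{i+1}`: an element of `Rᵢ` of value `< 1` divided by `π` lies in `R_{i+1}`. [folklore] -/
theorem div_mem_succ_of_lt (i : ℕ) (y : K) (hy : y ∈ R i) (hvy : O.valuation y < 1) : y / π ∈ R (i + 1) := by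
  obtain ⟨hπi, hRi⟩ := succ_eq_locAtCentre_blowupRing R h0 hstep π hπR hπ0 hvπ hπ i
  have hdom : SubringDominates (R i) O.toSubring := (sequence_dominates h0 hstep i).1
  have hym : (⟨y, hy⟩ : R i) ∈ maximalIdeal (R i) :=
    ((subringDominates_valuationSubring_iff hdom.1).mp hdom ⟨y, hy⟩).mpr hvy
  rw [hRi]
  exact le_locAtCentre _ O (div_mem_blowupRing π hym)

/-- `𝔪ᵢ^d ⊆ π^d R_{i+1}`. [folklore] -/
theorem div_pow_mem_succ_of_mem_pow (i : ℕ) :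
    ∀ (d : ℕ) (y : R i), y ∈ maximalIdeal (R i) ^ d → (y : K) / π ^ d ∈ R (i + 1) := by
  have hdom : SubringDominates (R i) O.toSubring := (sequence_dominates h0 hstep i).1
  have hmem : ∀ a : R i, a ∈ maximalIdeal (R i) ↔ O.valuation (a : K) < 1 :=
    (subringDominates_valuationSubring_iff hdom.1).mp hdom
  have hle : R i ≤ R (i + 1) := (hstep i).le
  intro d
  induction d with
  | zero => intro y _; rw [pow_zero, div_one]; exact hle y.2
  | succ d ih =>
    intro y hy
    rw [pow_succ] at hy
    refine Submodule.mul_induction_on hy (fun a ha b hb => ?_) (fun a b ha hb => ?_)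
    · have e : ((a * b : R i) : K) / π ^ (d + 1) = ((a : K) / π ^ d) * ((b : K) / π) := by
        rw [Subring.coe_mul, pow_succ, div_mul_div_comm]
      rw [e]
      exact (R (i + 1)).mul_mem (ih a ha) (div_mem_succ_of_lt R h0 hstep π hπR hπ0 hvπ hπ i b b.2 ((hmem b).mp hb))
    · rw [Subring.coe_add, add_div]
      exact (R (i + 1)).add_mem ha hb

/-- **Peeling.** An element of `Rᵢ` of value `(v π)^e` is `π^e · u` with `u ∈ R_{i+e}` of value `1` (a unit there). [folklore] -/
theorem exists_eq_pow_mul_unit :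
    ∀ (e i : ℕ) (g : K), g ∈ R i → O.valuation g = O.valuation π ^ e →
      ∃ u : K, u ∈ R (i + e) ∧ O.valuation u = 1 ∧ g = π ^ e * u := by
  intro e
  induction e with
  | zero => intro i g hg hv; exact ⟨g, by simpa using hg, by rw [hv, pow_zero], by rw [pow_zero, one_mul]⟩
  | succ e ih =>
    intro i g hg hv
    have hvg : O.valuation g < 1 := by
      rw [hv]; exact pow_lt_one₀ zero_le hvπ (by omega)
    have hg' : g / π ∈ R (i + 1) := div_mem_succ_of_lt R h0 hstep π hπR hπ0 hvπ hπ i g hg hvg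
    have hv' : O.valuation (g / π) = O.valuation π ^ e := by
      have hvπ0 : O.valuation π ≠ 0 := (Valuation.ne_zero_iff _).mpr hπ0
      rw [map_div₀, hv, pow_succ, mul_div_cancel_right₀ _ hvπ0]
    obtain ⟨u, hu, hvu, hgu⟩ := ih (i + 1) (g / π) hg' hv'
    refine ⟨u, by rw [← add_assoc, add_right_comm]; exact hu, hvu, ?_⟩
    rw [pow_succ, mul_comm (π ^ e) π, mul_assoc, ← hgu, mul_div_cancel₀ _ hπ0]

omit hR hπR hπ0 hvπ hπ in
/-- An element of value `1` of `Rᵢ` is a unit of `Rᵢ`. [folklore] -/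
theorem isUnit_of_valuation_eq_one (i : ℕ) (u : K) (hu : u ∈ R i) (hvu : O.valuation u = 1) : IsUnit (⟨u, hu⟩ : R i) := by
  have hdom : SubringDominates (R i) O.toSubring := (sequence_dominates h0 hstep i).1
  have hu0 : u ≠ 0 := ne_zero_of_valuation_eq_one hvu
  have huinvO : u⁻¹ ∈ O.toSubring := by
    change u⁻¹ ∈ O; rw [← O.valuation_le_one_iff, map_inv₀, hvu, inv_one]
  exact (isUnit_subring_iff_inv_mem _).mpr ⟨hu0, hdom.2 u hu huinvO⟩

/-- **Tower form with `Q`-constant digits.**  If every residue of every `Rᵢ` is a `p`-th power, then every `y ∈ 𝔪₀` is, for every `j`,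
`y = P(π) + π^j θ` with `P` a polynomial whose coefficients are `Q = p^s`-th powers of elements of `Rⱼ` and `θ ∈ 𝔪ⱼ`. [folklore] -/
theorem exists_tower_form {p : ℕ} [Fact p.Prime] [CharP K p]
    (hperf : ∀ (i : ℕ) (b : K), b ∈ R i → ∃ t : K, t ∈ R i ∧ O.valuation (b - t ^ p) < 1) (s : ℕ) :
    ∀ (j : ℕ) (y : K), y ∈ R 0 → O.valuation y < 1 →
      ∃ (P : Polynomial ((R j).map (iterateFrobenius K p s))) (θ : K), θ ∈ R j ∧ O.valuation θ < 1 ∧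
        y = Polynomial.aeval π P + π ^ j * θ := by
  intro j
  induction j with
  | zero => intro y hy hvy; exact ⟨0, y, hy, hvy, by simp⟩
  | succ j ih =>
    intro y hy hvy
    obtain ⟨P, θ, hθ, hvθ, hyeq⟩ := ih y hy hvy
    -- divide the remainder by `π` and split off its `Q`-constant digit
    have hρ : θ / π ∈ R (j + 1) := div_mem_succ_of_lt R h0 hstep π hπR hπ0 hvπ hπ j θ hθ hvθ
    obtain ⟨t, ht, hvt⟩ := exists_sub_pow_pow_lt_subring O (R (j + 1)) (hperf (j + 1)) s (θ / π) hρ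
    let T' : Subring K := (R (j + 1)).map (iterateFrobenius K p s)
    have htQ : t ^ p ^ s ∈ T' := Subring.mem_map.mpr ⟨t, ht, iterateFrobenius_def ..⟩
    have hle : (R j).map (iterateFrobenius K p s) ≤ T' := fun z hz => by
      obtain ⟨r, hr, rfl⟩ := Subring.mem_map.mp hz
      exact Subring.mem_map.mpr ⟨r, (hstep j).le hr, rfl⟩
    let incl := Subring.inclusion hle
    refine ⟨P.map incl + Polynomial.C ⟨t ^ p ^ s, htQ⟩ * Polynomial.X ^ (j + 1), θ / π - t ^ p ^ s,
      (R (j + 1)).sub_mem hρ ((R (j + 1)).pow_mem ht _), hvt, ?_⟩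
    have e1 : Polynomial.aeval π (P.map incl) = Polynomial.aeval π P := by
      rw [Polynomial.aeval_def, Polynomial.eval₂_map, Polynomial.aeval_def]; rfl
    rw [map_add, e1, map_mul, map_pow, Polynomial.aeval_X, Polynomial.aeval_C]
    change y = Polynomial.aeval π P + t ^ p ^ s * π ^ (j + 1) + π ^ (j + 1) * (θ / π - t ^ p ^ s)
    rw [hyeq, pow_succ]
    field_simp
    ring

end Tower

end Summit.ResolutionOfSingularities.ResolutionOfSingularities.Theorems.RadicialJung.CleanModels

end
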